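import Mathlib
import Summits.KontsevichZagierPeriods.Zeta5Search.ClassTypeGuardsI
import Summits.KontsevichZagierPeriods.Zeta5Search.ShapeClauseTransfer
import Summits.KontsevichZagierPeriods.Zeta5Search.LawA5Proof
import HarnessLib

/-!
# ζ(5) search — a COVER KIT for THEOREM L5 (`SecondOrder.lawA5_holds`, `casLB + 5` / rung CR⁺ one level up) — DENOM-LAW prover-d1 gen 3

HONEST FRAMING: systematic search; no irrationality claim unless certified.  Cell `pub-zeta5`, track «DENOM-LAW», seat `denom-prover-d1`
gen 3 (ATTEMPT-4 §5b).  `p`-adic valuation bounds for the explicit rationals `Cas_j(b)`; nothing about ζ(5); no model exponent moves.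

THEOREM L5 (`SecondResidueLaw.LawA5`, PROVED: `SecondOrder.lawA5_holds`, typer gen 13) needs, in the frame `(M, T)` (`M ≥ 10` even, `T` a
palindrome): the class clauses `LawA4Classes` AND the shape clause `ShapeClause` for `b` AND for `b + e_j`, and the degree condition
`p(M − 4) ≤ 2d(b) + 1`; then `v_p(Cas_j(b)) ≥ 8 − 2M`.  The tree used it per instance (`RecFrameL5*`, `Ray4FrameL5*`, `L5Shape*`: `decide` on
`LawA4ClassesD`/`ShapeClauseD`).  This file is the ALL-`n` tool, in the style of `ClassTypeGuardsI.lawA3_of_cover` / `DenomLaw.cover_CR`: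
a type-level Boolean check `checkL5` of the six clauses over a class-type COVER of the residues (`ClassTypeCover.Cover`), the theorem
`lawA5_of_cover` (the clauses for `b + e_j` come from typer gen 13's TRANSPORT `lawA4Classes_shift` / `shapeClause_shift`, so only the
datum `b` is covered), and the window wrapper `cover_L5`.  MOTIVATION (ATTEMPT-4 §5b): in the SHIFTED frame `(M, T) := (1 − m, P)` — `m` the odd
least multipole exponent, `P` the palindrome of the unit-moved deep type, deep level `−M` EMPTY — L5 is the rung "CR⁺" = `casLB + 3`, which the
exact data show TIGHT on clean half-cells of the census rays (TS8 `(19n/2, 10n]`, X2 `(14n, 44n/3]`); the companion files prove those windows for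
all `n` with this kit.  Valuations of explicit rationals; every model exponent these feed is `< 1`; records in print UNMOVED.
-/

open Finset

namespace Summit.KontsevichZagierPeriods.Zeta5Search.DenomLaw

open Summit.KontsevichZagierPeriods.Zeta5Search.ClusterValuation
open Summit.KontsevichZagierPeriods.Zeta5Search.CasoratianValuation (InPolytope shift casoratian)
open Summit.KontsevichZagierPeriods.Zeta5Search.WedgeDictionary (dOf)
open Summit.KontsevichZagierPeriods.Zeta5Search.ClassTypeCover
open Summit.KontsevichZagierPeriods.Zeta5Search.SecondOrder (classTypeList isRaise isRaise2 lawA5_holds lawA4Classes_shift shapeClause_shift)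
open Summit.KontsevichZagierPeriods.Zeta5Search.RecordWindowsA4 (LawA4Classes)
open Summit.KontsevichZagierPeriods.Zeta5Search.SecondResidueLaw (isRaiseN ShapeClause)

/-- Type-level check of the SIX clauses of THEOREM L5 at the frame `(M, T)`: the five `LawA4Classes` clauses (every multipole type has
`E ≥ −M`; singles `ν ≥ −M+1`; multipole types of exponent `−M` are centre-free with list `T`; pole types with `ν = −M+1` are single raises of `T`
or the odd-centre type `T`; pole types with `ν = −M+2` are admissible double raises) and the shape clause (pole types with `ν = −M+3` are
degree-3 T-shapes, or odd-centre degree-2 T-shapes). -/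
def checkL5 (odd : Bool) (TY : List (List ℤ × Bool)) (M : ℕ) (T : List ℤ) : Bool :=
  TY.all fun tc =>
    (decide (polesL tc.1 < 2) || decide (-(M : ℤ) ≤ expL odd tc.1 tc.2)) &&
    (!decide (polesL tc.1 = 1) || decide (-(M : ℤ) + 1 ≤ nuL odd tc.1 tc.2)) &&
    (!(decide (2 ≤ polesL tc.1) && decide (expL odd tc.1 tc.2 = -(M : ℤ))) || (!tc.2 && decide (tc.1 = T))) &&
    (!(decide (1 ≤ polesL tc.1) && decide (nuL odd tc.1 tc.2 = -(M : ℤ) + 1)) ||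
      (isRaise T tc.1 || (odd && tc.2 && decide (tc.1 = T)))) &&
    (!(decide (1 ≤ polesL tc.1) && decide (nuL odd tc.1 tc.2 = -(M : ℤ) + 2)) || isRaise2 T tc.1) &&
    (!(decide (1 ≤ polesL tc.1) && decide (nuL odd tc.1 tc.2 = -(M : ℤ) + 3)) ||
      (isRaiseN 3 T tc.1 || (odd && tc.2 && isRaiseN 2 T tc.1)))

variable {p : ℕ}

/-- **The six clauses of `b` from a cover**: `LawA4Classes b p M T ∧ ShapeClause b p M T`. -/
theorem clausesL5_of_cover [Fact p.Prime] {b : ℕ → ℤ} {TY : List (List ℤ × Bool)} (hcov : Cover b p TY) {M : ℕ} {T : List ℤ}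
    (hchk : checkL5 (decide (¬ (2 : ℤ) ∣ b 0)) TY M T = true) : LawA4Classes b p M T ∧ ShapeClause b p M T := by
  rw [checkL5, List.all_eq_true] at hchk
  refine ⟨⟨?_, ?_, ?_, ?_, ?_⟩, ?_⟩
  · intro x hxm
    obtain ⟨hx, h2⟩ := (mem_multipoleClasses_iff b p x).1 hxm
    obtain ⟨tc, htc, ht⟩ := hcov x hx
    have hc := hchk tc htc
    simp only [Bool.and_eq_true, Bool.or_eq_true, decide_eq_true_eq] at hc
    rw [ht.classPoleCount_eq] at h2
    rw [ht.classExp_eq]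
    rcases hc.1.1.1.1.1 with h | h
    · omega
    · exact h
  · intro y hy h1
    obtain ⟨tc, htc, ht⟩ := hcov y hy
    have hc := hchk tc htc
    simp only [Bool.and_eq_true, Bool.or_eq_true, Bool.not_eq_true', decide_eq_false_iff_not, decide_eq_true_eq] at hc
    rw [ht.classPoleCount_eq] at h1
    rw [ht.classNu_eq]
    rcases hc.1.1.1.1.2 with h | h
    · exact absurd h1 h
    · exact h
  · intro x hxm hE
    obtain ⟨hx, h2⟩ := (mem_multipoleClasses_iff b p x).1 hxm
    obtain ⟨tc, htc, ht⟩ := hcov x hx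
    have hc := hchk tc htc
    simp only [Bool.and_eq_true, Bool.or_eq_true, Bool.not_eq_true', Bool.and_eq_false_iff, decide_eq_false_iff_not,
      decide_eq_true_eq] at hc
    rw [ht.classPoleCount_eq] at h2
    rw [ht.classExp_eq] at hE
    rcases hc.1.1.1.2 with (h | h) | ⟨hc1, hc2⟩
    · omega
    · exact absurd hE h
    · refine ⟨fun hcen => ?_, by rw [ht.classTypeList_eq]; exact hc2⟩
      rw [ht.cen_iff.1 hcen] at hc1
      exact Bool.noConfusion hc1
  · intro y hy h1 hnu
    obtain ⟨tc, htc, ht⟩ := hcov y hy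
    have hc := hchk tc htc
    simp only [Bool.and_eq_true, Bool.or_eq_true, Bool.not_eq_true', Bool.and_eq_false_iff, decide_eq_false_iff_not,
      decide_eq_true_eq] at hc
    rw [ht.classPoleCount_eq] at h1
    rw [ht.classNu_eq] at hnu
    rcases hc.1.1.2 with (h | h) | (h | ⟨⟨ho, hc1⟩, hc2⟩)
    · omega
    · exact absurd hnu h
    · left; rw [ht.classTypeList_eq]; exact h
    · right
      exact ⟨ho, ht.cen_iff.2 hc1, by rw [ht.classTypeList_eq]; exact hc2⟩
  · intro z hz h1 hnu
    obtain ⟨tc, htc, ht⟩ := hcov z hz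
    have hc := hchk tc htc
    simp only [Bool.and_eq_true, Bool.or_eq_true, Bool.not_eq_true', Bool.and_eq_false_iff, decide_eq_false_iff_not,
      decide_eq_true_eq] at hc
    rw [ht.classPoleCount_eq] at h1
    rw [ht.classNu_eq] at hnu
    rcases hc.1.2 with (h | h) | h
    · omega
    · exact absurd hnu h
    · rw [ht.classTypeList_eq]; exact h
  · intro z hz h1 hnu
    obtain ⟨tc, htc, ht⟩ := hcov z hz
    have hc := hchk tc htc
    simp only [Bool.and_eq_true, Bool.or_eq_true, Bool.not_eq_true', Bool.and_eq_false_iff, decide_eq_false_iff_not,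
      decide_eq_true_eq] at hc
    rw [ht.classPoleCount_eq] at h1
    rw [ht.classNu_eq] at hnu
    rcases hc.2 with (h | h) | (h | ⟨⟨ho, hc1⟩, hc2⟩)
    · omega
    · exact absurd hnu h
    · left; rw [ht.classTypeList_eq]; exact h
    · right
      exact ⟨ho, ht.cen_iff.2 hc1, by rw [ht.classTypeList_eq]; exact hc2⟩

/-- **THEOREM L5 from a cover of `b` alone**: `8 − 2M ≤ v_p(Cas_j(b))` (the clauses for `b + e_j` by transport). -/
theorem lawA5_of_cover {b : ℕ → ℤ} {j : ℕ} (hb : InPolytope b) (hb' : InPolytope (shift b j)) (hj1 : 1 ≤ j) (hj7 : j ≤ 7)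
    (hpr : p.Prime) (hp5 : 5 ≤ p) (hpb : (p : ℤ) ≤ b 0) (hwin : (b 0 + 2 : ℤ) < (p : ℤ) ^ 2)
    {TY : List (List ℤ × Bool)} (hcov : Cover b p TY) {M : ℕ} (hM : 10 ≤ M) (hMe : Even M) {T : List ℤ} (hT : T.reverse = T)
    (hchk : checkL5 (decide (¬ (2 : ℤ) ∣ b 0)) TY M T = true) (hdeg : (p : ℤ) * ((M : ℤ) - 4) ≤ 2 * dOf b + 1)
    (hcas : casoratian b j ≠ 0) : (8 : ℤ) - 2 * M ≤ padicValRat p (casoratian b j) := by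
  haveI : Fact p.Prime := ⟨hpr⟩
  obtain ⟨hC, hS⟩ := clausesL5_of_cover hcov hchk
  have hC' := lawA4Classes_shift b hb hb' hj1 hj7 hpb (by omega) hC
  have hS' := shapeClause_shift b hb hb' hj1 hj7 hpb (by omega) hC hS
  exact lawA5_holds b p j M T hb hb' hj1 hj7 hpr hp5 hpb hwin hM hMe hT hC hC' hS hS' hdeg hcas

/-- **WINDOW BOUND by THEOREM L5 from a cover**: `c ≤ v_p(Cas_j(b))` whenever `c ≤ 8 − 2M`. -/
theorem cover_L5 {b : ℕ → ℤ} {j : ℕ} (hb : InPolytope b) (hb' : InPolytope (shift b j)) (hj1 : 1 ≤ j) (hj7 : j ≤ 7)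
    (hpr : p.Prime) (hp5 : 5 ≤ p) (hpb : (p : ℤ) ≤ b 0) (hwin : (b 0 + 2 : ℤ) < (p : ℤ) ^ 2)
    {TY : List (List ℤ × Bool)} (hcov : Cover b p TY) {M : ℕ} (hM : 10 ≤ M) (hMe : Even M) {T : List ℤ} (hT : T.reverse = T)
    (hchk : checkL5 (decide (¬ (2 : ℤ) ∣ b 0)) TY M T = true) (hdeg : (p : ℤ) * ((M : ℤ) - 4) ≤ 2 * dOf b + 1)
    {c : ℤ} (hc : c ≤ 8 - 2 * (M : ℤ)) (hcas : casoratian b j ≠ 0) : c ≤ padicValRat p (casoratian b j) :=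
  le_trans hc (lawA5_of_cover hb hb' hj1 hj7 hpr hp5 hpb hwin hcov hM hMe hT hchk hdeg hcas)

/-- Sanity of `checkL5` on the TS8 upper-half-cell types in the shifted frame `(M, T) = (10, [1,−6,−6,1])` (the CR-deep types `[1,−6,−5,1]`,
`[1,−5,−6,1]` sit at `ν = −M+1 = −9` as single raises; `[1,−5,−5,1]` at `−8` is a double raise; `[1,−4,−5,1]` at `−7` a degree-3 shape),
and a failing set (a 3-point type `[0,−6,−2]` at `ν = −8` is not an admissible double raise). -/
example : checkL5 false [([1, -6, -5, 1], false), ([1, -5, -6, 1], false), ([1, -5, -5, 1], false), ([1, -4, -5, 1], false),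
    ([1, -6, 1], false), ([1, 1], false)] 10 [1, -6, -6, 1] = true ∧
    checkL5 false [([1, -6, -5, 1], false), ([0, -6, -2], false)] 10 [1, -6, -6, 1] = false := by decide

end Summit.KontsevichZagierPeriods.Zeta5Search.DenomLaw
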